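import Literature.NumberTheory.Automorphic.LanglandsTunnellModThree
import Literature.NumberTheory.Automorphic.TunnellOctahedralGlobal
import Literature.NumberTheory.Automorphic.CDTTheorem712
import Literature.NumberTheory.GaloisRepresentations.FramedRepTwist
import HarnessLib

/-!
# STUB-IDEAS `stub_modThree`, ideator k = 2, generation 5 (RESHAPE): cell 3a = Langlands'
# *Base Change for GL(2)* Thm. 3.5 pinned at `2`, with the weight-one package dissolved into
# the tree's dictionary

Companion to `STUB-IDEAS-stub_modThree-2.md` (crux dir of `FreyModularity`, route DefiniteXi).
Generation 4 (`STUB_IDEAS_stub_modThree_2g4.lean`, namespace `…Sketch.StubIdeasModThreeK2G4`)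
closed the cell "`ρ̄` surjective, `ρ̄(I₂)` non-abelian" WITHOUT Tunnell through two named facts,
the PIN (F3) and a monolithic weight-one package (F4).  Generation 5 reshapes both:

* the pin is re-typed in Galois form (`IsPinnedAt`: one Frobenius above `v` outside `Γ_E`, no
  line fixed by `I_𝔓 ∩ Γ_E`) and anchored in print: it is Langlands 1980, §3 **Theorem 3.5**
  (octahedral `ρ`, `E` imaginary, one non-split place where `ρ_v` is locally irreducible on
  `W_{E_w}`; Langlands asks "`ρ_v` dihedral", the local Langlands correspondence for `GL₂(ℚ₂)`
  upgrades this to "irreducible");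
* F4 is DISSOLVED: its only transcendental content is archimedean (F5, the `hpair` debt class:
  strong base change at `∞`); everything else is provable from the tree — the weight-one
  dictionary needs `IsPiOfArtinRep σ π` only through the central character (W0, W), the newform
  of `π` is `σ`-free (N), Deligne–Serre gives `ρ_f` with `π = π(ρ_f)` a.e., base change transports
  this to `E` (C1a), two Artin representations attached to `Π_E` have equal characteristic
  polynomials (C1b, six-line proof recorded; `sorry` only for the farm snapshot), Clifford at index two produces a sign character `χ` with
  `σ ∼ ρ_f ⊗ χ` (C2), and the newform of `f ⊗ χ` carries `σ` (T, Shimura 3.64 = the tree's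
  proved `exists_isNewform1_twist`);
* the field is concrete: `E = CyclotomicField 3 ℚ`, `Γ_E = ker χ̄₃ = {det ρ̄ = 1}` by the tree's
  `range_absGaloisRestrict_eq_absGaloisGroupAdjoinRootsOfUnity` (H1a), and the local half of the
  pin is a finite check on `SL₂(𝔽₃)` (H1c, `decide`).

Everything here elaborates; `sorry` only in the helper theorems marked (H·/W·/N/C·/T/K1).  Proved:
`det_commDiff_ne_zero` (H1c-fin, `decide`), `isOdd_of_isTorsionGaloisRep`, and the three compositions
`langlands_tunnell_of_descent5`, `coreCellQ8_of_pin5`, `stub_modThree_of_plan5`.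
-/

noncomputable section

open scoped MatrixGroups NumberField Polynomial Classical ModularForm
open NumberField IsDedekindDomain Field Polynomial Filter CongruenceSubgroup
open Literature.NumberTheory.GaloisRepresentations Literature.NumberTheory.Automorphic
open Literature.NumberTheory.EllipticCurves.ModularForms Rat.HeightOneSpectrum
open WeierstrassCurve

namespace Summit.ABC.ABC.Cruxes.FreyModularity.Sketch.StubIdeasModThreeK2G5

/-! ### Carried over from generation 4 (verbatim) -/

/-- The registered stub's signature, verbatim. -/
abbrev SigStubModThree : Prop :=
  ∀ (W : WeierstrassCurve ℚ) [W.IsElliptic] (ρ : ModPGaloisRep ℚ (ZMod 3) 2),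
    W.IsTorsionGaloisRep 3 ρ → FramedRep.IsAbsolutelyIrreducible ρ → ρ.IsModular

/-- The finite place `2` of `ℚ`. -/
def placeTwo : HeightOneSpectrum (𝓞 ℚ) := Rat.HeightOneSpectrum.primesEquiv.symm ⟨2, Nat.prime_two⟩

/-- `ρ̄(I₂)` is non-abelian (inside `SL₂(𝔽₃)`: `ρ̄(I₂) ∈ {Q₈, SL₂(𝔽₃)}`). -/
def HasNonabelianInertiaAtTwo (ρ : ModPGaloisRep ℚ (ZMod 3) 2) : Prop :=
  ∃ 𝔔 ∈ placeTwo.primesAbove, ∃ τ₁ ∈ 𝔔.inertia (Field.absoluteGaloisGroup ℚ),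
    ∃ τ₂ ∈ 𝔔.inertia (Field.absoluteGaloisGroup ℚ), ρ τ₁ * ρ τ₂ ≠ ρ τ₂ * ρ τ₁

/-- **Cell 3a** — surjective `ρ̄` with non-abelian inertia at `2` (the Tunnell-free cell). -/
def CoreCellQ8 : Prop :=
  ∀ (W : WeierstrassCurve ℚ) [W.IsElliptic] (ρ : ModPGaloisRep ℚ (ZMod 3) 2),
    W.IsTorsionGaloisRep 3 ρ → FramedRep.IsAbsolutelyIrreducible ρ →
    Function.Surjective ρ → HasNonabelianInertiaAtTwo ρ → ρ.IsModular

/-- "The central character of `π` is `det σ`", almost-everywhere Satake form. -/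
def CentralCharIsDet {F : Type} [Field F] [NumberField F] (σ : FramedArtinRep F 2)
    {hF : isCompact_glFiniteIntegralLevel 2 F} (π : AutomorphicRepData (AutomorphyDatum.gl 2 F hF)) :
    Prop :=
  ∀ᶠ u : HeightOneSpectrum (𝓞 F) in Filter.cofinite, ∀ α : Multiset ℂ, π.HasSatakeParamAt u α →
    ∀ 𝔓 ∈ u.primesAbove, ∀ τ : Field.absoluteGaloisGroup F, IsArithFrobAt (𝓞 F) τ 𝔓 →
      α.prod = ((Matrix.GeneralLinearGroup.det (σ τ) : ℂˣ) : ℂ)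

/-! ### Generation 5: the re-typed objects -/

/-- The determinant field `ℚ(ζ₃) = ℚ(√-3)` as a concrete type. -/
abbrev E₃ : Type := CyclotomicField 3 ℚ

/-- **The pin, Galois form.**  `σ` is PINNED at `v` along `E/F`: above `v` there is a prime `𝔓` with an
arithmetic Frobenius OUTSIDE `Γ_E` (so `v` does not split in `E`) and such that `I_𝔓 ∩ Γ_E` fixes no
line of `ℂ²` (so `σ|_{W_{E_w}}` is irreducible).  This is the hypothesis of Langlands 1980 Thm. 3.5
with "`ρ_v` dihedral" upgraded to "`ρ_v|_{W_{E_w}}` irreducible". -/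
def IsPinnedAt {F : Type} [Field F] [NumberField F] (E : Type) [Field E] [Algebra F E]
    (σ : FramedArtinRep F 2) (v : HeightOneSpectrum (𝓞 F)) : Prop :=
  ∃ 𝔓 ∈ v.primesAbove,
    (∃ Φ : Field.absoluteGaloisGroup F, IsArithFrobAt (𝓞 F) Φ 𝔓 ∧ Φ ∉ (absGaloisRestrict F E).range) ∧
    ¬ ∃ u : Fin 2 → ℂ, u ≠ 0 ∧ ∀ τ ∈ 𝔓.inertia (Field.absoluteGaloisGroup F),
        τ ∈ (absGaloisRestrict F E).range →
        ∃ c : ℂ, ((σ τ : GL (Fin 2) ℂ) : Matrix (Fin 2) (Fin 2) ℂ).mulVec u = c • u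

/-- **Central-character data** — EXACTLY the conclusion of the tree's
`IsPiOfArtinRep.exists_centralCharacter_eq_det`, which is all that the weight-one lemmas
`add_eq_zero_of_hasArchParameter` / `rightTranslation_ofArch_neg_one_add_mem` consume. -/
def CentralCharacterData {F : Type} [Field F] [NumberField F] (σ : FramedArtinRep F 2)
    {hF : isCompact_glFiniteIntegralLevel 2 F} (π : AutomorphicRepData (AutomorphyDatum.gl 2 F hF)) :
    Prop :=
  ∃ ω : HeckeCharacter F, ω.IsFiniteOrder ∧
    (∀ (z : ideleGroup F), ∀ φ ∈ π.W, rightTranslation (AdelicGroupData.gl 2 F)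
        (Matrix.GeneralLinearGroup.scalar (Fin 2) z) φ - ((ω z : ℂˣ) : ℂ) • φ ∈ π.W') ∧
    ∀ v : HeightOneSpectrum (𝓞 F), σ.IsUnramifiedAt v → ω.IsUnramifiedAt v ∧
      ∀ 𝔓 ∈ v.primesAbove, ∀ Φ : Field.absoluteGaloisGroup F, IsArithFrobAt (𝓞 F) Φ 𝔓 →
        ω.valueAtUniformizer v = ((FramedRep.det σ Φ : ℂˣ) : ℂ)

/-- **Mirror of the tree's `AutomorphicRepData.IsOfWeightOne`** (`StrongArtinGL2WeightOneDictionary.lean:194`,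
VERBATIM body: archimedean parameter `{0,0}` and `-1_∞` acts by `-1` on `W/W'`), restated here only because that
module is outside today's farm snapshot; a prover imports the tree predicate and deletes this. -/
def IsOfWeightOneMirror {hcpt : isCompact_glFiniteIntegralLevel 2 ℚ}
    (π : AutomorphicRepData (AutomorphyDatum.gl 2 ℚ hcpt)) : Prop :=
  π.HasArchParameter (fun _ ↦ {0, 0}) ∧
    ∀ φ ∈ π.W,
      rightTranslation (AdelicGroupData.gl 2 ℚ)
          ((AutomorphyDatum.gl 2 ℚ hcpt).ofArch ⟨-1, trivial⟩) φ + φ ∈ π.W'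

/-- **(F3′) NAMED FACT — Langlands, *Base Change for GL(2)* (1980), §3 Thm. 3.5, with the local
Langlands correspondence for `GL₂` at the pinning place.**  `E/F` quadratic, `σ_E` irreducible of
TETRAHEDRAL type (Langlands' §3 setting: then `π(σ_E) = ⊗_w π(σ_{E,w})` exists in the strong sense, Thm. 3.3,
and equals `Π_E` by strong multiplicity one — no "a.e. ⇒ everywhere" transfer is hidden) with
`Π_E = π(σ_E)` a.e., `π` cuspidal with weak lift `Π_E`, `σ` pinned at some `v`.  Then `ω_π = det σ`
(a.e. Satake form).  Print: `η = ω_π ω_σ⁻¹` has order `≤ 2` and is trivial at split places, so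
`η ∈ {1, ω_{E/F}}` (§2 (C),(E)); at the pinning place `π_v` lifts to the supercuspidal
`Π_w = π(σ|_{W_{E_w}})` (Arthur–Clozel Thm. 5.1: weak ⇒ strong), hence `π_v = π(φ_v)` with
`φ_v|_{W_{E_w}} ≅ σ_v|_{W_{E_w}}` irreducible (LLC for `GL₂(F_v)` commutes with restriction,
Harris–Taylor VII.2.6 / Bushnell–Henniart), so `φ_v ≅ σ_v ⊗ η_v^a` and `det φ_v = det σ_v`, i.e.
`η_v = 1`; `v` non-split forces `η = 1`.
[cite: LanglandsBaseChange1980, §3 Thm. 3.5, §2 (C)(E)(F), §1 (c)(e)] [cite: ArthurClozelAMS120, Ch. 3 Thm. 5.1]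
[cite: Kutzko1980, Thm.] [cite: HarrisTaylor2001, Lemma VII.2.6] -/
def quadraticDescent_centralCharacter_pin5 : Prop :=
  ∀ (F E : Type) [Field F] [NumberField F] [Field E] [NumberField E] [Algebra F E],
    Module.finrank F E = 2 →
    ∀ (σ : FramedArtinRep F 2) (hF : isCompact_glFiniteIntegralLevel 2 F)
      (hE : isCompact_glFiniteIntegralLevel 2 E) (PE : CuspidalAutomorphicRepData 2 E hE)
      (π : CuspidalAutomorphicRepData 2 F hF) (v : HeightOneSpectrum (𝓞 F)),
      (σ.restrictField E).toGaloisRep.IsIrreducible →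
      IsTetrahedralType (σ.restrictField E).toMonoidHom →
      IsPiOfArtinRep (σ.restrictField E) PE.1 → IsWeakBaseChangeLiftAE π.1 PE.1 →
      IsPinnedAt E σ v → CentralCharIsDet σ π.1

/-- **(F5) NAMED FACT — the archimedean pair of a weak descent** (the `hpair` debt class of the
Tunnell road, nothing more): if `π` cuspidal on `GL₂(𝔸_ℚ)` lifts weakly to `Π_E = π(σ_E)` a.e.
(`σ_E` irreducible tetrahedral, so `Π_E = ⊗_w π(σ_{E,w})` strongly by Thm. 3.3 + JS), the archimedean
parameter of `π_∞` is a pair `{s, s}` (indeed `π_∞ ∈ {π(1,1), π(1,sgn), π(sgn,sgn)}`).  Print: weak ⇒ strong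
base change at `∞` (Arthur–Clozel Thm. 5.1), `Π_E = π(σ_E)` strongly (Langlands §3 + JS SMO), and
the archimedean lift `π(μ,ν)_ℝ ↦ π(μ∘N, ν∘N)_ℂ` (Langlands §1 (i), §2 (F)): `σ_{E,∞}` is trivial
for `E` imaginary, so `μ, ν ∈ {1, sgn}`, parameter `{0,0}`; for `E` real `π_∞ = π(σ_∞)`.
[cite: LanglandsBaseChange1980, §1 (i), §2 (F), §3 pp. 19–20] [cite: ArthurClozelAMS120, Ch. 3 Thm. 5.1]
[cite: JacquetShalika1981, Thm. 4.4] -/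
def hasArchPair_of_weakDescent : Prop :=
  ∀ (E : Type) [Field E] [NumberField E] [Algebra ℚ E], Module.finrank ℚ E = 2 →
    ∀ (σ : FramedArtinRep ℚ 2) (hQ : isCompact_glFiniteIntegralLevel 2 ℚ)
      (hE : isCompact_glFiniteIntegralLevel 2 E) (PE : CuspidalAutomorphicRepData 2 E hE)
      (π : CuspidalAutomorphicRepData 2 ℚ hQ),
      (σ.restrictField E).toGaloisRep.IsIrreducible →
      IsTetrahedralType (σ.restrictField E).toMonoidHom →
      IsPiOfArtinRep (σ.restrictField E) PE.1 → IsWeakBaseChangeLiftAE π.1 PE.1 →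
      ∃ s : ℂ, π.1.HasArchParameter fun _ => ({s, s} : Multiset ℂ)

/-! ### (H1) The Galois side of the pin for `E[3]` — concrete over `E₃ = ℚ(ζ₃)` -/

/-- `[ℚ(ζ₃) : ℚ] = 2` (PROVED: `IsCyclotomicExtension.finrank` + `cyclotomic.irreducible_rat`). -/
theorem finrank_E₃ : Module.finrank ℚ E₃ = 2 := by
  haveI : NeZero ((3 : ℕ) : ℚ) := ⟨by norm_num⟩
  haveI : IsCyclotomicExtension {3} ℚ E₃ := CyclotomicField.isCyclotomicExtension 3 ℚ
  have h : Module.finrank ℚ E₃ = Nat.totient 3 :=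
    IsCyclotomicExtension.finrank E₃ (Polynomial.cyclotomic.irreducible_rat (by norm_num))
  rw [h, Nat.totient_prime Nat.prime_three]

/-- **(H1a, S)** `Γ_{ℚ(ζ₃)} = ker χ̄₃ = {det ρ̄ = 1}`: the tree's
`range_absGaloisRestrict_eq_absGaloisGroupAdjoinRootsOfUnity` + `mem_absGaloisGroupAdjoinRootsOfUnity_iff`
+ `modNCyclotomicCharacter_spec`, and `det ρ̄ = χ̄₃` (`det_eq_modPCyclotomicCharacter_of_isTorsionGaloisRep_holds`). -/
theorem mem_range_absGaloisRestrict_E₃_iff (W : WeierstrassCurve ℚ) [W.IsElliptic]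
    (ρ : ModPGaloisRep ℚ (ZMod 3) 2) (hρ : W.IsTorsionGaloisRep 3 ρ) (g : Field.absoluteGaloisGroup ℚ) :
    g ∈ (absGaloisRestrict ℚ E₃).range ↔ Matrix.GeneralLinearGroup.det (ρ g) = 1 := by
  sorry

/-- The entrywise difference `x y - y x` on the tree's encoding `M2` of `2 × 2` matrices over `ℤ[√-2]`. -/
def commDiff (x y : GL2F3Lift.M2) : GL2F3Lift.M2 :=
  ⟨(GL2F3Lift.M2.mul x y).a - (GL2F3Lift.M2.mul y x).a, (GL2F3Lift.M2.mul x y).b - (GL2F3Lift.M2.mul y x).b,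
   (GL2F3Lift.M2.mul x y).c - (GL2F3Lift.M2.mul y x).c, (GL2F3Lift.M2.mul x y).d - (GL2F3Lift.M2.mul y x).d⟩

/-- **(H1c-fin, XS, kernel decision)** For two NON-COMMUTING elements `x, y` of `Ψ(SL₂(𝔽₃)) ⊂ GL₂(ℤ[√-2])`,
`det (xy - yx) ≠ 0` — so `Ψ(x), Ψ(y)` have no common eigenvector in `ℂ²` (a common eigenvector `u`
gives `(xy - yx) u = 0`).  Finite check over the tree's list `elemsSL` (24 × 24 pairs). -/
theorem det_commDiff_ne_zero :
    ∀ x ∈ GL2F3Lift.M2.elemsSL, ∀ y ∈ GL2F3Lift.M2.elemsSL,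
      GL2F3Lift.M2.mul x y ≠ GL2F3Lift.M2.mul y x → GL2F3Lift.M2.det (commDiff x y) ≠ 0 := by
  decide

/-- **(H1, S/M)** the pin datum for `ρ̄ = E[3]` surjective with non-abelian inertia at `2`, over the
concrete field `E₃ = ℚ(ζ₃)`: `σ = Ψ∘ρ̄` restricted to `Γ_{E₃} = {det ρ̄ = 1}` has image `Ψ(SL₂(𝔽₃))`
(irreducible, projectively `A₄` = tetrahedral); `χ̄₃(Frob₂) = 2 ≠ 1` puts a Frobenius at `2` outside
`Γ_{E₃}` (`modNCyclotomicCharacter_eq_residueCard_of_isArithFrobAt`); `χ̄₃` unramified at `2` puts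
`I_𝔔 ≤ Γ_{E₃}`, and two non-commuting `ρ̄(τ₁), ρ̄(τ₂) ∈ SL₂(𝔽₃)` have `Ψ`-images without common
eigenvector (`det_commDiff_ne_zero`, `psi_injective`, `embHom_injective`). -/
theorem pinData_E₃ (W : WeierstrassCurve ℚ) [W.IsElliptic] (ρ : ModPGaloisRep ℚ (ZMod 3) 2)
    (hρ : W.IsTorsionGaloisRep 3 ρ) (hs : Function.Surjective ρ) (hn : HasNonabelianInertiaAtTwo ρ) :
    ((modThreeLift ρ).restrictField E₃).toGaloisRep.IsIrreducible ∧
      IsTetrahedralType ((modThreeLift ρ).restrictField E₃).toMonoidHom ∧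
      IsPinnedAt E₃ (modThreeLift ρ) placeTwo := by
  sorry

/-! ### (H2) Descent datum (generation 4, verbatim; template = first half of the tree's PROVED
`strongArtin_of_isOctahedralType_of_tunnell_lemma`) -/

/-- **(H2, M)** `Π_E = π(σ_E)` (tetrahedral Langlands) is Galois-stable a.e.
(`isGaloisStableSatakeAE_of_isPiOfArtinRep`) and descends cyclically (`cuspidal_descent_cyclic`). -/
theorem exists_descent_of_isTetrahedralType_restrictField
    (hT : strongArtin_of_isTetrahedralType) (hD : cuspidal_descent_cyclic)
    (hQ : isCompact_glFiniteIntegralLevel 2 ℚ)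
    (E : Type) [Field E] [NumberField E] [Algebra ℚ E] (hdeg : Module.finrank ℚ E = 2)
    (σ : FramedArtinRep ℚ 2) (hirr : (σ.restrictField E).toGaloisRep.IsIrreducible)
    (htet : IsTetrahedralType (σ.restrictField E).toMonoidHom) :
    ∃ (hE : isCompact_glFiniteIntegralLevel 2 E) (PE : CuspidalAutomorphicRepData 2 E hE)
      (π : CuspidalAutomorphicRepData 2 ℚ hQ),
      IsPiOfArtinRep (σ.restrictField E) PE.1 ∧ IsWeakBaseChangeLiftAE π.1 PE.1 := by
  sorry

/-! ### (W0, W, N) The weight-one dictionary, `σ`-free -/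

/-- **(W0, S)** a.e. `∏ t_{π,v} = det σ(Frob_v)` ⇒ central-character data: copy the proof of
`IsPiOfArtinRep.exists_centralCharacter_eq_det` (`π.exists_centralCharacter`,
`artinReciprocity_character_holds` for `det σ` — PROVED in the tree —,
`HeckeCharacter.ext_of_eventually_valueAtUniformizer_eq`, `hasSatakeParamAt_cofinite_holds`). -/
theorem centralCharacterData_of_centralCharIsDet {F : Type} [Field F] [NumberField F]
    (σ : FramedArtinRep F 2) {hF : isCompact_glFiniteIntegralLevel 2 F}
    (π : CuspidalAutomorphicRepData 2 F hF) (h : CentralCharIsDet σ π.1) :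
    CentralCharacterData σ π.1 := by
  sorry

/-- **(W, S)** weight one from central-character data + odd + an archimedean PAIR: the proofs of
`IsPiOfArtinRep.add_eq_zero_of_hasArchParameter` (`s + s = 0`) and
`IsPiOfArtinRep.rightTranslation_ofArch_neg_one_add_mem` (`-1_∞` acts by `det σ(c) = -1`) use
`IsPiOfArtinRep` ONLY through `exists_centralCharacter_eq_det`; rerun them on the datum. -/
theorem isOfWeightOne_of_centralCharacterData {hQ : isCompact_glFiniteIntegralLevel 2 ℚ}
    (σ : FramedArtinRep ℚ 2) (hodd : σ.IsOdd) (π : CuspidalAutomorphicRepData 2 ℚ hQ)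
    (hω : CentralCharacterData σ π.1) {s : ℂ}
    (hs : π.1.HasArchParameter fun _ => ({s, s} : Multiset ℂ)) : IsOfWeightOneMirror π.1 := by
  sorry

/-- **(N, S/M)** the newform of a weight-one `π` — `σ`-FREE dictionary: the lambda inside
`exists_isNewform1_of_isPiOfArtinRep_of_isOfWeightOne_of_fixed` (`IsOfWeightOne.exists_isNewform1_of_exists_fixed`,
`CuspidalAutomorphicRepData.exists_gammaOneFiniteLevel_fixed`, `hasSatakeParamAt_of_adelicLiftFunA_mem`,
`heckeT_eq_heckeEigenvalue_smul`, `IsNewform1.heckeEigenvalue_eq_coeff_holds`). -/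
theorem exists_newform_of_isOfWeightOne {hQ : isCompact_glFiniteIntegralLevel 2 ℚ}
    (π : CuspidalAutomorphicRepData 2 ℚ hQ) (hπ : IsOfWeightOneMirror π.1) :
    ∃ (N : ℕ) (_ : NeZero N) (f : CuspForm (Gamma1 N) 1), IsNewform1 f ∧
      ∀ v : HeightOneSpectrum (𝓞 ℚ), ¬ ((primesEquiv v : Nat.Primes) : ℕ) ∣ N →
        ∃ α : Multiset ℂ, π.1.HasSatakeParamAt v α ∧
          satakePolynomial α =
            (Literature.NumberTheory.EllipticCurves.ModularForms.heckePolynomial f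
              (primesEquiv v : Nat.Primes)).map (algebraMap (coeffCharField f) ℂ) := by
  sorry

/-- **(N′, S)** Deligne–Serre's `ρ_f` is `π` a.e.: at `p ∤ N` the Satake polynomial of `π` is the Hecke
polynomial of `f`, which is the Frobenius polynomial of `ρ_f` (`IsGaloisRepOfNewform1`). -/
theorem isPiOfArtinRep_of_dictionary {hQ : isCompact_glFiniteIntegralLevel 2 ℚ}
    (π : CuspidalAutomorphicRepData 2 ℚ hQ) {N : ℕ} [NeZero N] {f : CuspForm (Gamma1 N) 1}
    (hsat : ∀ v : HeightOneSpectrum (𝓞 ℚ), ¬ ((primesEquiv v : Nat.Primes) : ℕ) ∣ N →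
      ∃ α : Multiset ℂ, π.1.HasSatakeParamAt v α ∧
        satakePolynomial α =
          (Literature.NumberTheory.EllipticCurves.ModularForms.heckePolynomial f
            (primesEquiv v : Nat.Primes)).map (algebraMap (coeffCharField f) ℂ))
    (ρ' : FramedArtinRep ℚ 2)
    (hρ' : IsGaloisRepOfNewform1 f (algebraMap (coeffCharField f) ℂ) {p | p ∣ N} ρ') :
    IsPiOfArtinRep ρ' π.1 := by
  sorry

/-! ### (C1a, C1b, C2, T) Galois-side comparison: base change, SMO, Clifford, untwist -/

/-- **(C1a, M)** `π = π(ρ')` a.e. over `F` and `Π_E` a weak lift of `π` ⇒ `Π_E = π(ρ'_E)` a.e.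
(Frobenius data restrict as `β ↦ β^{f(w|v)}`: `FramedGaloisRep.hasFrobCharpolyAt_restrictField_fin_two`;
a.e. bookkeeping `eventually_forall_under_eq`; same computation as the tree's PROVED
`isGaloisStableSatakeAE_of_isPiOfArtinRep`). -/
theorem isPiOfArtinRep_restrictField_of_isWeakBaseChangeLiftAE {F E : Type} [Field F] [NumberField F]
    [Field E] [NumberField E] [Algebra F E] {hF : isCompact_glFiniteIntegralLevel 2 F}
    {hE : isCompact_glFiniteIntegralLevel 2 E} (ρ' : FramedArtinRep F 2)
    (π : CuspidalAutomorphicRepData 2 F hF) (PE : CuspidalAutomorphicRepData 2 E hE)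
    (hρ' : IsPiOfArtinRep ρ' π.1) (hBC : IsWeakBaseChangeLiftAE π.1 PE.1) :
    IsPiOfArtinRep (ρ'.restrictField E) PE.1 := by
  sorry

/-- **(C1b, S)** two Artin representations attached a.e. to the same `Π` have equal characteristic
polynomials everywhere (`FramedArtinRep.charpoly_eq_of_eventually_hasFrobCharpolyAt`, Satake uniqueness). -/
theorem charpoly_eq_of_isPiOfArtinRep_pair {E : Type} [Field E] [NumberField E]
    {hE : isCompact_glFiniteIntegralLevel 2 E} (σ₁ σ₂ : FramedArtinRep E 2)
    (PE : CuspidalAutomorphicRepData 2 E hE) (h₁ : IsPiOfArtinRep σ₁ PE.1) (h₂ : IsPiOfArtinRep σ₂ PE.1)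
    (g : Field.absoluteGaloisGroup E) : FramedRep.charpoly σ₁ g = FramedRep.charpoly σ₂ g := by
  /- PROOF (S; six lines, checked shape — needs `import …Automorphic.AutomorphicRepsGLSatakeFlathProofs` and
     `…GaloisRepresentations.ArtinRepGaloisSideSMOProofs`, both outside today's farm snapshot):
    have hae : ∀ᶠ v in cofinite, ∃ P : ℂ[X], σ₁.HasFrobCharpolyAt v P ∧ σ₂.HasFrobCharpolyAt v P := by
      refine (h₁.and h₂).mono ?_
      rintro v ⟨⟨α, hα, -, hP⟩, ⟨α', hα', -, hP'⟩⟩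
      have e : α = α' := AutomorphicRepData.hasSatakeParamAt_unique_holds PE.1 hα hα'
      subst e
      exact ⟨_, hP, hP'⟩
    exact FramedArtinRep.charpoly_eq_of_eventually_hasFrobCharpolyAt σ₁ σ₂ hae g -/
  sorry

/-- **(C2, M/L — Clifford at index two, character theory)** `σ, ρ'` rank-`2` Artin representations of
`Γ_F`, `ρ'` irreducible, `σ|_{Γ_E}` irreducible (`[E:F] = 2`) and `charpoly ρ'|_{Γ_E} = charpoly σ|_{Γ_E}`.
Then `σ ∼ ρ' ⊗ χ` (equal characteristic polynomials) for a sign character `χ` trivial on `Γ_E`.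
Proof: on the finite group `G = Γ_F/(ker σ ∩ ker ρ')` with `H` the image of `Γ_E` (index `2`, sign `ε`),
`⟨χ_{ρ'}, χ_σ⟩_G + ⟨χ_{ρ'}, ε χ_σ⟩_G = (2|H|/|G|) ⟨χ_σ|_H, χ_σ|_H⟩_H = 1`, a sum of two multiplicities
(Mathlib `FDRep.char_orthonormal`), so `ρ' ≅ σ` or `ρ' ≅ σ ⊗ ε`; in rank `2` the character determines the
characteristic polynomial (`2 det = χ(g)² - χ(g²)`).  [Serre, *Linear Representations*, §7.2 Prop. 20;
Clifford 1937] -/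
theorem clifford_index_two {F E : Type} [Field F] [NumberField F] [Field E] [NumberField E]
    [Algebra F E] (hdeg : Module.finrank F E = 2) (σ ρ' : FramedArtinRep F 2)
    (hfinσ : (Set.range σ).Finite) (hfinρ : (Set.range ρ').Finite)
    (hirrE : (σ.restrictField E).toGaloisRep.IsIrreducible) (hirr' : ρ'.toGaloisRep.IsIrreducible)
    (hH : ∀ g : Field.absoluteGaloisGroup E,
      FramedRep.charpoly (ρ'.restrictField E) g = FramedRep.charpoly (σ.restrictField E) g) :
    ∃ χ : Field.absoluteGaloisGroup F →ₜ* ℂˣ,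
      (∀ g, g ∈ (absGaloisRestrict F E).range → χ g = 1) ∧ (∀ g, χ g = 1 ∨ χ g = -1) ∧
      ∀ g, FramedRep.charpoly σ g = FramedRep.charpoly (FramedRep.twist ρ' χ) g := by
  sorry

/-- **(T, M — untwisting in weight one; Shimura Prop. 3.64 / Atkin–Li)** if `σ ∼ ρ_f ⊗ χ` for a sign
character `χ` of `Γ_ℚ` and `ρ_f` is attached to the weight-one newform `f`, then `σ` is attached to a
weight-one newform (the newform of `f ⊗ χ'`, `χ'` the primitive Dirichlet character of `χ`):
`exists_isPrimitive_dirichletCharacter_eq_dirichletGaloisCharacter` (Kronecker–Weber, PROVED),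
`exists_isNewform1_twist` (PROVED), `EllipticCurves.FramedGaloisRep.hasFrobCharpolyAt_twist_two`,
Deligne–Serre for the twisted newform and the cofinite transfer pattern of
`isGaloisRepOfNewform1_of_isPiOfArtinRep_of_satake_cofinite`.  Template in weight `≥ 2`:
`exists_isNewform1_isGaloisRepOfNewform1_of_eigenform_twist`. -/
theorem exists_newform_untwist {σ ρ' : FramedArtinRep ℚ 2} {χ : Field.absoluteGaloisGroup ℚ →ₜ* ℂˣ}
    (hχ : ∀ g, χ g = 1 ∨ χ g = -1)
    (hcmp : ∀ g, FramedRep.charpoly σ g = FramedRep.charpoly (FramedRep.twist ρ' χ) g)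
    {N : ℕ} [NeZero N] {f : CuspForm (Gamma1 N) 1} (hf : IsNewform1 f)
    (hρ' : IsGaloisRepOfNewform1 f (algebraMap (coeffCharField f) ℂ) {p | p ∣ N} ρ')
    (hDS : ∀ {M : ℕ} [NeZero M], exists_complexGaloisRep_of_weight_one (N := M)) :
    ∃ (N' : ℕ) (_ : NeZero N') (f' : CuspForm (Gamma1 N') 1), IsNewform1 f' ∧
      IsGaloisRepOfNewform1 f' (algebraMap (coeffCharField f') ℂ) {p | p ∣ N'} σ := by
  sorry

/-! ### (K1) pointwise Langlands–Tunnell ⇒ modular (PROVED by k = 1, restated) -/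

/-- **(K1)** `…Sketch.StubModThreeIdeasK1G2.isModular_of_langlands_tunnell_at`
(`STUB_IDEAS_stub_modThree_1.lean:81`, 0 sorries); restated because crux-dir files are not importable. -/
theorem isModular_of_langlands_tunnell_at (ρ : ModPGaloisRep ℚ (ZMod 3) 2)
    (hLT : langlands_tunnell (modThreeLift ρ)) (habs : FramedRep.IsAbsolutelyIrreducible ρ)
    (hodd : FramedGaloisRep.IsOdd ρ) : ρ.IsModular := by
  sorry

/-- Oddness of `ρ̄ = E[3]` from `det ρ̄ = χ̄₃` (PROVED, as in generation 4). -/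
theorem isOdd_of_isTorsionGaloisRep (W : WeierstrassCurve ℚ) [W.IsElliptic]
    (ρ : ModPGaloisRep ℚ (ZMod 3) 2) (hρ : W.IsTorsionGaloisRep 3 ρ) : FramedGaloisRep.IsOdd ρ := by
  haveI : NeZero ((3 : ℕ) : ℚ) := ⟨by norm_num⟩
  intro φ c hc
  rw [W.det_eq_modPCyclotomicCharacter_of_isTorsionGaloisRep_holds 3 ρ hρ c]
  ext
  rw [modPCyclotomicCharacterZMod_eq_modNCyclotomicCharacter,
    modNCyclotomicCharacter_of_isComplexConjugation hc, Units.val_neg, Units.val_one]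

/-- `σ = Ψ∘ρ̄` has finite image (it factors through `GL₂(𝔽₃)`). -/
theorem finite_range_modThreeLift (ρ : ModPGaloisRep ℚ (ZMod 3) 2) :
    (Set.range (modThreeLift ρ)).Finite := by
  have h : Set.range (modThreeLift ρ) ⊆ Set.range GL2F3Lift.psi := by
    rintro _ ⟨g, rfl⟩
    exact ⟨ρ g, (modThreeLift_apply ρ g).symm⟩
  exact (Set.finite_range _).subset h

/-! ### The kernel-checked compositions -/

/-- **LANGLANDS–TUNNELL FOR `σ` FROM A PINNED DESCENT (kernel-checked).**  Debts visible in the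
binders: F5 (arch pair) and Deligne–Serre; everything else is a helper of this file. -/
theorem langlands_tunnell_of_descent5 (hA : hasArchPair_of_weakDescent)
    (hDS : ∀ {N : ℕ} [NeZero N], exists_complexGaloisRep_of_weight_one (N := N))
    (E : Type) [Field E] [NumberField E] [Algebra ℚ E] (hdeg : Module.finrank ℚ E = 2)
    (σ : FramedArtinRep ℚ 2) {hQ : isCompact_glFiniteIntegralLevel 2 ℚ}
    {hE : isCompact_glFiniteIntegralLevel 2 E} (PE : CuspidalAutomorphicRepData 2 E hE)
    (π : CuspidalAutomorphicRepData 2 ℚ hQ) (hodd : σ.IsOdd) (hfin : (Set.range σ).Finite)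
    (hirrE : (σ.restrictField E).toGaloisRep.IsIrreducible)
    (htet : IsTetrahedralType (σ.restrictField E).toMonoidHom)
    (hPE : IsPiOfArtinRep (σ.restrictField E) PE.1) (hBC : IsWeakBaseChangeLiftAE π.1 PE.1)
    (hcc : CentralCharIsDet σ π.1) : langlands_tunnell σ := by
  intro _ _ _
  obtain ⟨s, hs⟩ := hA E hdeg σ hQ hE PE π hirrE htet hPE hBC
  have hω : CentralCharacterData σ π.1 := centralCharacterData_of_centralCharIsDet σ π hcc
  have hw1 : IsOfWeightOneMirror π.1 := isOfWeightOne_of_centralCharacterData σ hodd π hω hs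
  obtain ⟨N, hN, f, hf, hsat⟩ := exists_newform_of_isOfWeightOne π hw1
  obtain ⟨ρ', hρ', hirr', hfin', -⟩ := hDS hf
  have hπρ' : IsPiOfArtinRep ρ' π.1 := isPiOfArtinRep_of_dictionary π hsat ρ' hρ'
  have hρ'E : IsPiOfArtinRep (ρ'.restrictField E) PE.1 :=
    isPiOfArtinRep_restrictField_of_isWeakBaseChangeLiftAE ρ' π PE hπρ' hBC
  have hH : ∀ g : Field.absoluteGaloisGroup E,
      FramedRep.charpoly (ρ'.restrictField E) g = FramedRep.charpoly (σ.restrictField E) g :=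
    fun g => charpoly_eq_of_isPiOfArtinRep_pair _ _ PE hρ'E hPE g
  obtain ⟨χ, -, hχ, hcmp⟩ := clifford_index_two hdeg σ ρ' hfin hfin' hirrE hirr' hH
  exact exists_newform_untwist hχ hcmp hf hρ' hDS

/-- **CELL 3a FROM THE PIN (kernel-checked).**  Debts: Langlands' tetrahedral theorem (tree leaf),
cyclic descent (tree leaf), the pin F3′ (Langlands 1980 Thm. 3.5 + LLC at `2`), the archimedean pair
F5 (`hpair` class), Deligne–Serre (tree leaf), `isCompact_glFiniteIntegralLevel 2 ℚ`.
No `tunnell_lemma`, no JPSS, no 2-adic lifting, no monolithic F4. -/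
theorem coreCellQ8_of_pin5 (hT : strongArtin_of_isTetrahedralType) (hD : cuspidal_descent_cyclic)
    (hP : quadraticDescent_centralCharacter_pin5) (hA : hasArchPair_of_weakDescent)
    (hDS : ∀ {N : ℕ} [NeZero N], exists_complexGaloisRep_of_weight_one (N := N))
    (hQ : isCompact_glFiniteIntegralLevel 2 ℚ) : CoreCellQ8 := by
  intro W _ ρ hρ habs hs hn
  have hodd : FramedGaloisRep.IsOdd ρ := isOdd_of_isTorsionGaloisRep W ρ hρ
  obtain ⟨hirr, htet, hpin⟩ := pinData_E₃ W ρ hρ hs hn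
  obtain ⟨hE, PE, π, hPE, hBC⟩ :=
    exists_descent_of_isTetrahedralType_restrictField hT hD hQ E₃ finrank_E₃ (modThreeLift ρ) hirr htet
  have hcc : CentralCharIsDet (modThreeLift ρ) π.1 :=
    hP ℚ E₃ finrank_E₃ (modThreeLift ρ) hQ hE PE π placeTwo hirr htet hPE hBC hpin
  have hLT : langlands_tunnell (modThreeLift ρ) :=
    langlands_tunnell_of_descent5 hA hDS E₃ finrank_E₃ (modThreeLift ρ) PE π
      (isOdd_modThreeLift hodd) (finite_range_modThreeLift ρ) hirr htet hPE hBC hcc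
  exact isModular_of_langlands_tunnell_at ρ hLT habs hodd

/-- **The generation-5 plan with its debts named.**  The complement of cell 3a (not surjective, or
abelian inertia at `2` — generation 3's cells 1, 2, 3b: the CM congruence engine, the 3–2 switch +
Allen road of k = 3, or Langlands–Tunnell pointwise as in k = 1) is ONE hypothesis `hrest`. -/
theorem stub_modThree_of_plan5
    (hrest : ∀ (W : WeierstrassCurve ℚ) [W.IsElliptic] (ρ : ModPGaloisRep ℚ (ZMod 3) 2),
      W.IsTorsionGaloisRep 3 ρ → FramedRep.IsAbsolutelyIrreducible ρ →
      ¬ (Function.Surjective ρ ∧ HasNonabelianInertiaAtTwo ρ) → ρ.IsModular)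
    (hT : strongArtin_of_isTetrahedralType) (hD : cuspidal_descent_cyclic)
    (hP : quadraticDescent_centralCharacter_pin5) (hA : hasArchPair_of_weakDescent)
    (hDS : ∀ {N : ℕ} [NeZero N], exists_complexGaloisRep_of_weight_one (N := N))
    (hQ : isCompact_glFiniteIntegralLevel 2 ℚ) : SigStubModThree := by
  intro W _ ρ hρ habs
  by_cases h : Function.Surjective ρ ∧ HasNonabelianInertiaAtTwo ρ
  · exact coreCellQ8_of_pin5 hT hD hP hA hDS hQ W ρ hρ habs h.1 h.2
  · exact hrest W ρ hρ habs h

end Summit.ABC.ABC.Cruxes.FreyModularity.Sketch.StubIdeasModThreeK2G5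

end
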